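/-
Copyright (c) 2026 the pub-hodgecm-mathlib formalisation cell (harness21).  Prover seat hodgecm-mathlib-A-p03 (g24); LEAD F0P3a-plan (g9) WORD T8-41 «(F4)–(F8) PEN 1»,
architect A-p06 (g26) («(C) coset level»), 2026-09-01.
-/
import Literature.NumberTheory.Automorphic.UnitaryThreePHTowerRho
import Literature.NumberTheory.LocalFields.UnramifiedQuadraticNormQuadraticCount
import HarnessLib

/-!
# Flicker's Prop. 10, LAYER B: the coset count in the fourth regime `ν = N₊`, `m ≤ ν < 2m` — `[N₀ : P_H ∩ H^K_m] · #{pairs}`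

Topic `NumberTheory/Automorphic` (road «D-N7-inert», MAP v3 (F4) LAYER B); namespace `Literature.NumberTheory.Automorphic.UnitaryGroup` (B-p17's frame, ★ defs
`flickerPH`∕`flickerHK` p840993, ★ B-p04 `flickerPH0` p841106 and `flickerPHRho` = `ρ_m`).  THEOREMS ONLY: no definition, no named fact, no instance, no notation,
no `sorry`; kernel lane.

THE MATHEMATICS [Flicker1998UnitaryFL, Prop. 10 p. 86, case «`ν′ = ν″ < m`»].  In the regime `|B₂| = |A − b| = |ϖ^ν|`, `m ≤ ν`, `ν + k = 2m` (`k ≥ 1`), for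
`p = p(u,x,w) ∈ P_H` the condition «`p⁻¹ τ p ∈ H^K_m`» is (§2, ★ core §4) `|n²(1−x²) + d n + ϖ^{2j}| ≤ |ϖ^k|` with `n = uσu = N(u w⁻¹)`, `d = 2(A−b)∕B₂`, i.e.
(§3) a predicate of `ρ_m(p) = (u w⁻¹, x) mod 𝓂^m` alone, namely the predicate counted by ★ `natCard_pairs_norm_quadratic_eq` at `R = 𝒪[K]`.  Since the fibres of `ρ_m` on
`P_H ⧸ (P_H ∩ H^K_m)` all have `[N₀ : P_H ∩ H^K_m]` elements ((H2), B-p04 (g33) FILE C — taken here as the hypothesis `hfib`) and the image is «unit × anti-fixed»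
(★ (H3)), §4 gives `#{good cosets} = [N₀ : P_H ∩ H^K_m] · q^m · q^{m−k} · q^{m−1}(q+1)`; with `[N₀ : P_H ∩ H^K_m] = q^m` and `k = 2m − ν` this is Flicker's
`(1 + q⁻¹) q^{ν + 2m}` (★ `iTen`, third branch).  §1: the generic fibre-counting lemma and the σ-defect of Flicker's `B∕B″`
(`σr − r = 2(a−b)(c−b)∕(b(a−c))` for `r = (a+c−2b)∕(a−c)`, norm-one `a, b, c`), which supplies the hypothesis `|σd − d| ≤ |ϖ^k|` from `N₁ + N₂ − ν ≥ k`.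
HONEST LABEL: HC_CM is proved only modulo the printed citations until rung 0 closes; this file is group bookkeeping + finite counting.

## References
* [Flicker1998UnitaryFL] Y. Z. Flicker, *Elementary proof of the fundamental lemma for a unitary group*, Canad. J. Math. 50 (1998), 74–98: Prop. 8 p. 84, Prop. 10 pp. 85–86.
* [Rogawski1990] J. D. Rogawski, *Automorphic Representations of Unitary Groups in Three Variables* (1990), §4.9 p. 55.
-/

set_option autoImplicit false

open scoped MatrixGroups WithZero Valued
open Matrix

namespace Literature.NumberTheory.Automorphic

namespace UnitaryGroup

open Literature.NumberTheory.Automorphic.HermitianLattice (unitaryInt mem_unitaryInt_iff LocalConjDatum)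
open Literature.NumberTheory.LocalFields.UnramifiedQuadraticNorm IsLocalRing

/-! ## §1 Two generic lemmas -/

/-- **Counting through a map with equal fibres**: if every fibre of `f : α → β` over its range has `c` elements, then for a predicate `G` on `β`,
`#{a : G (f a)} = c · #{b ∈ range f : G b}`. [cite: Flicker1998UnitaryFL, Prop. 10 p. 86] -/
theorem natCard_subtype_comp_eq_mul {α β : Type*} [Finite α] (f : α → β) (G : β → Prop) (c : ℕ)
    (hc : ∀ b ∈ Set.range f, Nat.card {a : α // f a = b} = c) :
    Nat.card {a : α // G (f a)} = c * Nat.card {b : β // b ∈ Set.range f ∧ G b} := by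
  classical
  haveI : Finite (Set.range f) := (Set.finite_range f).to_subtype
  haveI : Finite {b : β // b ∈ Set.range f ∧ G b} :=
    Finite.of_injective (fun b : {b : β // b ∈ Set.range f ∧ G b} => (⟨b.1, b.2.1⟩ : Set.range f))
      (fun x y h => Subtype.ext (by simpa using congrArg Subtype.val h))
  letI : Fintype {b : β // b ∈ Set.range f ∧ G b} := Fintype.ofFinite _
  have e := (Equiv.sigmaSubtypeFiberEquivSubtype f (p := fun a => G (f a)) (q := fun b => b ∈ Set.range f ∧ G b)
    (fun a => ⟨fun h => ⟨⟨a, rfl⟩, h⟩, fun h => h.2⟩)).symm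
  rw [Nat.card_congr e, Nat.card_sigma, Finset.sum_congr rfl fun x _ => hc x.1 x.2.1, Finset.sum_const, smul_eq_mul,
    Finset.card_univ, ← Nat.card_eq_fintype_card, mul_comm]

variable {K : Type*} [Field K] [Valued K ℤᵐ⁰] {ϖ : K} (σ : K →+* K) {J : Matrix (Fin 3) (Fin 3) K}

omit [Valued K ℤᵐ⁰] in
/-- **The σ-defect of Flicker's `B∕B″`**: for norm-one `a, b, c` (`σz = z⁻¹`) and `r = (a + c − 2b)∕(a − c)`, `σr − r = 2(a−b)(c−b)∕(b(a−c))` — so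
`|σr − r| = |a−b||c−b|∕|a−c|`, i.e. `d = 2(A−b)∕B₂ = −2ϖ^j r` is σ-fixed modulo `ϖ^{j+N₁+N₂−N}`. [cite: Flicker1998UnitaryFL, Prop. 10 p. 86] -/
theorem map_ratio_sub_ratio {a b c : K} (ha : σ a = a⁻¹) (hb : σ b = b⁻¹) (hc : σ c = c⁻¹) (ha0 : a ≠ 0) (hb0 : b ≠ 0) (hc0 : c ≠ 0)
    (hac : a ≠ c) :
    σ ((a + c - 2 * b) / (a - c)) - (a + c - 2 * b) / (a - c) = 2 * (a - b) * (c - b) / (b * (a - c)) := by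
  have hac' : a - c ≠ 0 := sub_ne_zero.2 hac
  have hac'' : a⁻¹ - c⁻¹ ≠ 0 := by
    rw [sub_ne_zero]; exact fun h => hac (inv_injective h)
  rw [map_div₀, map_sub, map_add, map_sub, map_mul, map_ofNat, ha, hb, hc]
  field_simp
  ring

/-! ## §2 Regime 4 in coordinates: «`p⁻¹ τ p ∈ H^K_m`» ⟺ the quadratic valuation inequality -/

/-- **Regime 4 in coordinates**: for `p = p(u,x,w) ∈ P_H`, `τ = !![A,0,B₂ϖ^{2j}; 0,b,0; B₂,0,A] ∈ H` with `|B₂| = |ϖ^ν| = |A − b|` (`N₊ = ν`), `m ≤ ν`, `ν + k = 2m`: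
`p⁻¹ τ p ∈ H^K_m ↔ |n²(1−x²) + d·n + ϖ^{2j}| ≤ |ϖ^k|`, `n = uσu`, `d = 2(A−b)∕B₂` (★ `condition_four_iff_quadratic`; conditions (1)–(3) hold automatically).
[cite: Flicker1998UnitaryFL, Prop. 10 p. 86] -/
theorem borel_conj_mem_flickerHK_iff_quadratic (hJ : J = (StdForm.antidiagonal 3).over K) (hd : LocalConjDatum σ ϖ) {y : K}
    (hy : y * σ y = -2) {m ν k j : ℕ} (hmν : m ≤ ν) (hνk : ν + k = 2 * m)
    {c um p τ : ↥(unitaryGroupOfForm σ J)} (hc : ((c : GL (Fin 3) K) : Matrix (Fin 3) (Fin 3) K) = !![1, 0, 0; 0, -1, 0; 0, 0, 1])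
    (hum : ((um : GL (Fin 3) K) : Matrix (Fin 3) (Fin 3) K) = !![ϖ ^ m, y, (ϖ ^ m)⁻¹; 0, 1, -σ y * (ϖ ^ m)⁻¹; 0, 0, (ϖ ^ m)⁻¹])
    {u x w A B₂ b : K} (hp : p ∈ flickerPH σ J c)
    (hpm : ((p : GL (Fin 3) K) : Matrix (Fin 3) (Fin 3) K) = !![u, 0, u * x; 0, w, 0; 0, 0, (σ u)⁻¹])
    (hτ : ((τ : GL (Fin 3) K) : Matrix (Fin 3) (Fin 3) K) = !![A, 0, B₂ * ϖ ^ (2 * j); 0, b, 0; B₂, 0, A])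
    (hτH : τ ∈ Subgroup.centralizer ({c} : Set ↥(unitaryGroupOfForm σ J)))
    (hB₂ : Valued.v B₂ = Valued.v (ϖ ^ ν)) (hs : Valued.v (A - b) = Valued.v (ϖ ^ ν)) :
    p⁻¹ * τ * p ∈ flickerHK σ J c um ↔
      Valued.v ((u * σ u) ^ 2 * (1 - x ^ 2) + (2 * (A - b) / B₂) * (u * σ u) + ϖ ^ (2 * j)) ≤ Valued.v (ϖ ^ k) := by
  have h2 : (2 : K) ≠ 0 := fun h => by have := hd.v2; rw [h, map_zero] at this; exact zero_ne_one this
  have hϖ0 : ϖ ≠ 0 := hd.ϖ_ne_zero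
  obtain ⟨u', x', w', hpm', hvu, hvx, hσx, hvw, hσw⟩ := exists_coe_eq_borel_of_mem_flickerPH σ hJ hd hc hp
  have hu' : u' = u := by have := congrFun (congrFun (hpm'.symm.trans hpm) 0) 0; simpa using this
  have hw' : w' = w := by have := congrFun (congrFun (hpm'.symm.trans hpm) 1) 1; simpa using this
  subst hu' hw'
  have hu0 : u' ≠ 0 := fun h => by rw [h, map_zero] at hvu; exact zero_ne_one hvu
  have hx' : x' = x := by
    have := congrFun (congrFun (hpm'.symm.trans hpm) 0) 2
    simpa [hu0] using this
  subst hx'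
  have hσu0 : σ u' ≠ 0 := fun h => hu0 (by rw [← hd.σσ u', h, map_zero])
  have hw0 : w' ≠ 0 := fun h => by rw [h, map_zero] at hvw; exact zero_ne_one hvw
  have hpH : p ∈ Subgroup.centralizer ({c} : Set ↥(unitaryGroupOfForm σ J)) := ((mem_flickerPH_iff h2 hc).1 hp).1.1
  rw [borel_conj_mem_flickerHK_iff σ hJ hd hy m hu0 hσu0 hw0 hum hpm hτ hpH hτH]
  have hn : Valued.v (u' * σ u') = 1 := by rw [map_mul, hd.vσ, hvu, mul_one]
  have hB₂0 : B₂ ≠ 0 := fun h => by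
    rw [h, map_zero] at hB₂; exact (pow_ne_zero _ hϖ0) ((map_eq_zero _).1 hB₂.symm)
  have hmν' : Valued.v (ϖ ^ ν) ≤ Valued.v (ϖ ^ m) := by
    rw [hd.v_pow, hd.v_pow, WithZero.exp_le_exp]; omega
  have hB₂m : Valued.v B₂ ≤ Valued.v (ϖ ^ m) := hB₂ ▸ hmν'
  have c1 : Valued.v ((u' * σ u') * B₂) ≤ 1 := by rw [map_mul, hn, one_mul]; exact le_trans hB₂m (hd.v_pow_le_one m)
  have c23 := (two_congruences_iff_of_v_B₂_le (ϖ := ϖ) hB₂m hn hvx).2 (hs ▸ hmν')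
  rw [condition_four_iff_quadratic (ϖ := ϖ) hB₂0 hn rfl]
  have e : Valued.v (ϖ ^ m) * Valued.v (ϖ ^ m) = Valued.v (ϖ ^ ν) * Valued.v (ϖ ^ k) := by
    rw [← map_mul, ← map_mul, ← pow_add, ← pow_add]; congr 2; omega
  constructor
  · rintro ⟨-, -, -, h4⟩
    rw [hB₂, e] at h4
    have hpos : 0 < Valued.v (ϖ ^ ν) := by rw [hd.v_pow]; exact WithZero.zero_lt_coe _
    exact le_of_mul_le_mul_left h4 hpos
  · intro h4
    refine ⟨c1, c23.1, c23.2, ?_⟩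
    rw [hB₂, e]
    exact mul_le_mul_right h4 _

/-! ## §3 Regime 4 through `ρ_m` -/

/-- For `z ∈ 𝒪`: `φ(z mod 𝓂^m) = 0` in `𝒪⧸𝓂^k` iff `|z| ≤ |ϖ^k|` (`k ≤ m`). [cite: Flicker1998UnitaryFL, Prop. 10 p. 86] -/
theorem factor_mk_eq_zero_iff (hϖ : Valued.v ϖ = WithZero.exp (-1 : ℤ)) {k m : ℕ} (hkm : k ≤ m) (z : 𝒪[K]) :
    Ideal.Quotient.factor (Ideal.pow_le_pow_right hkm) (Ideal.Quotient.mk (𝓂[K] ^ m) z) = 0 ↔ Valued.v (z : K) ≤ Valued.v (ϖ ^ k) := by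
  rw [Ideal.Quotient.factor_mk, Ideal.Quotient.eq_zero_iff_mem, mem_maximalIdeal_pow_iff_v_le hϖ]

/-- **The quadratic inequality as a predicate on classes**: for integers `a, x, d` and `p₀ = ϖ^{2j}`, `|N(a)²(1−x²) + d N(a) + ϖ^{2j}| ≤ |ϖ^k|` iff
`φ((ā σ̄ā)²(1 − x̄²) + d̄ (ā σ̄ā) + p̄₀) = 0` in `𝒪⧸𝓂^k` (classes mod `𝓂^m`, `k ≤ m`). [cite: Flicker1998UnitaryFL, Prop. 10 p. 86] -/
theorem v_quadratic_le_iff_factor_eq_zero (hd : LocalConjDatum σ ϖ) (hσO : ∀ y : 𝒪[K], (σ.comp 𝒪[K].subtype) y ∈ 𝒪[K])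
    {k m : ℕ} (hkm : k ≤ m) {a x d : K} (ha : Valued.v a ≤ 1) (hx : Valued.v x ≤ 1) (hdv : Valued.v d ≤ 1) (j : ℕ) :
    Valued.v ((a * σ a) ^ 2 * (1 - x ^ 2) + d * (a * σ a) + ϖ ^ (2 * j)) ≤ Valued.v (ϖ ^ k) ↔
      Ideal.Quotient.factor (Ideal.pow_le_pow_right hkm)
        ((Ideal.Quotient.mk (𝓂[K] ^ m) ⟨a, ha⟩ *
            Ideal.quotientMap (𝓂[K] ^ m) ((σ.comp 𝒪[K].subtype).codRestrict 𝒪[K] hσO)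
              (maximalIdeal_pow_le_comap_codRestrict σ hd.vϖ hd.vσ hσO m) (Ideal.Quotient.mk (𝓂[K] ^ m) ⟨a, ha⟩)) ^ 2 *
            (1 - (Ideal.Quotient.mk (𝓂[K] ^ m) ⟨x, hx⟩) ^ 2) +
          Ideal.Quotient.mk (𝓂[K] ^ m) ⟨d, hdv⟩ *
            (Ideal.Quotient.mk (𝓂[K] ^ m) ⟨a, ha⟩ *
              Ideal.quotientMap (𝓂[K] ^ m) ((σ.comp 𝒪[K].subtype).codRestrict 𝒪[K] hσO)
                (maximalIdeal_pow_le_comap_codRestrict σ hd.vϖ hd.vσ hσO m) (Ideal.Quotient.mk (𝓂[K] ^ m) ⟨a, ha⟩)) +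
          Ideal.Quotient.mk (𝓂[K] ^ m) ⟨ϖ ^ (2 * j), hd.v_pow_le_one (2 * j)⟩) = 0 := by
  have hσa : Valued.v (σ a) ≤ 1 := by rw [hd.vσ]; exact ha
  set E₀ : 𝒪[K] := (⟨a, ha⟩ * ⟨σ a, hσa⟩) ^ 2 * (1 - ⟨x, hx⟩ ^ 2) + ⟨d, hdv⟩ * (⟨a, ha⟩ * ⟨σ a, hσa⟩) +
    ⟨ϖ ^ (2 * j), hd.v_pow_le_one (2 * j)⟩ with hE₀
  have hcoe : (E₀ : K) = (a * σ a) ^ 2 * (1 - x ^ 2) + d * (a * σ a) + ϖ ^ (2 * j) := by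
    simp [hE₀]
  have hσmk : Ideal.quotientMap (𝓂[K] ^ m) ((σ.comp 𝒪[K].subtype).codRestrict 𝒪[K] hσO)
      (maximalIdeal_pow_le_comap_codRestrict σ hd.vϖ hd.vσ hσO m) (Ideal.Quotient.mk (𝓂[K] ^ m) ⟨a, ha⟩) =
      Ideal.Quotient.mk (𝓂[K] ^ m) ⟨σ a, hσa⟩ := by
    rw [Ideal.quotientMap_mk]; rfl
  rw [hσmk, ← hcoe, ← factor_mk_eq_zero_iff hd.vϖ hkm E₀]
  simp only [hE₀, map_add, map_mul, map_pow, map_sub, map_one]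

/-! ## §4 The coset count in regime 4 -/

section RegimeFour

variable [IsDiscreteValuationRing 𝒪[K]] [Finite (ResidueField 𝒪[K])] [IsAdicComplete (maximalIdeal 𝒪[K]) 𝒪[K]]

/-- **PROP. 10, FOURTH REGIME, AS A COSET COUNT** (`|B₂| = |A − b| = |ϖ^ν|`, `1 ≤ m ≤ ν`, `ν + k = 2m`, `k ≥ 1`, `j ≥ 1`, `|σd − d| ≤ |ϖ^k|` for `d = 2(A−b)∕B₂`):
`#{y ∈ P_H ⧸ (P_H ∩ H^K_m) : y⁻¹ τ y ∈ H^K_m} = F · q^m · q^{m−k} · q^{m−1}(q+1)`, where `F` is the common size of the fibres of `ρ_m` on the coset space ((H2):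
`F = [N₀ : P_H ∩ H^K_m] = q^m`, B-p04 FILE C) — Flicker's `(1 + q⁻¹)q^{ν+2m}`.  Ingredients: §2–§3 (the condition is the quadratic predicate of `ρ_m`), ★ (H1)(H3)
(image = unit × anti-fixed, fibres = `N₀`-cosets), ★ `natCard_pairs_norm_quadratic_eq` at `R = 𝒪[K]`. [cite: Flicker1998UnitaryFL, Prop. 10 p. 86] -/
theorem natCard_cosets_regime_four (hJ : J = (StdForm.antidiagonal 3).over K) (hd : LocalConjDatum σ ϖ)
    (hσO : ∀ y : 𝒪[K], (σ.comp 𝒪[K].subtype) y ∈ 𝒪[K]) {y : K} (hy : y * σ y = -2)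
    {m ν k j : ℕ} (hm : 1 ≤ m) (hmν : m ≤ ν) (hνk : ν + k = 2 * m) (hk : 1 ≤ k) (hj : 1 ≤ j)
    {c um τ : ↥(unitaryGroupOfForm σ J)} (hc : ((c : GL (Fin 3) K) : Matrix (Fin 3) (Fin 3) K) = !![1, 0, 0; 0, -1, 0; 0, 0, 1])
    (hum : ((um : GL (Fin 3) K) : Matrix (Fin 3) (Fin 3) K) = !![ϖ ^ m, y, (ϖ ^ m)⁻¹; 0, 1, -σ y * (ϖ ^ m)⁻¹; 0, 0, (ϖ ^ m)⁻¹])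
    {A B₂ b : K} (hτ : ((τ : GL (Fin 3) K) : Matrix (Fin 3) (Fin 3) K) = !![A, 0, B₂ * ϖ ^ (2 * j); 0, b, 0; B₂, 0, A])
    (hτH : τ ∈ Subgroup.centralizer ({c} : Set ↥(unitaryGroupOfForm σ J)))
    (hB₂ : Valued.v B₂ = Valued.v (ϖ ^ ν)) (hs : Valued.v (A - b) = Valued.v (ϖ ^ ν))
    (hσd : Valued.v (σ (2 * (A - b) / B₂) - 2 * (A - b) / B₂) ≤ Valued.v (ϖ ^ k))
    {q : ℕ} (hq : Nat.card (ResidueField 𝒪[K]) = q ^ 2)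
    {a₀ : 𝒪[K]} (ha₀ : IsUnit (((σ.comp 𝒪[K].subtype).codRestrict 𝒪[K] hσO) a₀ - a₀))
    (hSN : flickerPH σ J c ⊓ flickerHK σ J c um ≤ flickerPH0 σ J c (ϖ ^ m))
    [Finite (↥(flickerPH σ J c) ⧸ (flickerHK σ J c um).subgroupOf (flickerPH σ J c))] {F : ℕ}
    (hfib : ∀ z ∈ Set.range (fun w : ↥(flickerPH σ J c) ⧸ (flickerHK σ J c um).subgroupOf (flickerPH σ J c) =>
        flickerPHRho σ m ((Quotient.out w : ↥(flickerPH σ J c)) : ↥(unitaryGroupOfForm σ J))),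
      Nat.card {w : ↥(flickerPH σ J c) ⧸ (flickerHK σ J c um).subgroupOf (flickerPH σ J c) //
        flickerPHRho σ m ((Quotient.out w : ↥(flickerPH σ J c)) : ↥(unitaryGroupOfForm σ J)) = z} = F) :
    Nat.card {w : ↥(flickerPH σ J c) ⧸ (flickerHK σ J c um).subgroupOf (flickerPH σ J c) //
      ((Quotient.out w : ↥(flickerPH σ J c)) : ↥(unitaryGroupOfForm σ J))⁻¹ * τ * (Quotient.out w : ↥(flickerPH σ J c)) ∈ flickerHK σ J c um} =
      F * (q ^ m * (q ^ (m - k) * (q ^ (m - 1) * (q + 1)))) := by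
  classical
  have h2v : Valued.v (2 : K) = 1 := hd.v2
  have h2 : (2 : K) ≠ 0 := fun h => by rw [h, map_zero] at h2v; exact zero_ne_one h2v
  have hϖ0 : ϖ ≠ 0 := hd.ϖ_ne_zero
  have hkm : k ≤ m := by omega
  -- the restricted involution and the data in `𝒪[K]`
  set σO : 𝒪[K] →+* 𝒪[K] := (σ.comp 𝒪[K].subtype).codRestrict 𝒪[K] hσO with hσOdef
  have hσOσO : ∀ z, σO (σO z) = z := fun z => Subtype.ext (hd.σσ (z : K))
  have hB₂0 : B₂ ≠ 0 := fun h => by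
    rw [h, map_zero] at hB₂; exact (pow_ne_zero _ hϖ0) ((map_eq_zero _).1 hB₂.symm)
  set d : K := 2 * (A - b) / B₂ with hddef
  have hdv : Valued.v d = 1 := by
    rw [hddef, map_div₀, map_mul, h2v, one_mul, hs, hB₂, div_self]
    rw [hd.v_pow]; exact WithZero.coe_ne_zero
  set d₀ : 𝒪[K] := ⟨d, hdv.le⟩ with hd₀
  have hd₀u : IsUnit d₀ := (Valuation.Integers.isUnit_iff_valuation_eq_one (Valuation.integer.integers _)).2 hdv
  have hσd₀ : σO d₀ - d₀ ∈ 𝓂[K] ^ k := by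
    rw [mem_maximalIdeal_pow_iff_v_le hd.vϖ]; exact hσd
  set p₀ : 𝒪[K] := ⟨ϖ ^ (2 * j), hd.v_pow_le_one (2 * j)⟩ with hp₀
  have hp₀m : p₀ ∈ 𝓂[K] := by
    rw [mem_maximalIdeal, mem_nonunits_iff, Valuation.Integers.isUnit_iff_valuation_eq_one (Valuation.integer.integers _)]
    change Valued.v (ϖ ^ (2 * j)) ≠ 1
    rw [hd.v_pow, ← WithZero.exp_zero, Ne, WithZero.exp_inj]; omega
  have hσp₀ : σO p₀ = p₀ := Subtype.ext (by change σ (ϖ ^ (2 * j)) = ϖ ^ (2 * j); rw [map_pow, hd.σϖ])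
  have h2O : IsUnit (2 : 𝒪[K]) :=
    (Valuation.Integers.isUnit_iff_valuation_eq_one (Valuation.integer.integers _)).2 (by rw [map_ofNat]; exact h2v)
  -- the predicate counted by the pair count, and the map `f = ρ_m ∘ out`
  set P := flickerPH σ J c with hPdef
  set S := (flickerHK σ J c um).subgroupOf (flickerPH σ J c) with hSdef
  set f : ↥P ⧸ S → (𝒪[K] ⧸ 𝓂[K] ^ m) × (𝒪[K] ⧸ 𝓂[K] ^ m) :=
    fun w => flickerPHRho σ m ((Quotient.out w : ↥P) : ↥(unitaryGroupOfForm σ J)) with hfdef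
  set Q : (𝒪[K] ⧸ 𝓂[K] ^ m) × (𝒪[K] ⧸ 𝓂[K] ^ m) → Prop := fun ux =>
    Ideal.quotientMap (maximalIdeal 𝒪[K] ^ m) σO (maximalIdeal_pow_le_comap σO hσOσO m) ux.2 = -ux.2 ∧ (IsUnit ux.1 ∧
      Ideal.Quotient.factor (Ideal.pow_le_pow_right hkm)
        ((ux.1 * Ideal.quotientMap (maximalIdeal 𝒪[K] ^ m) σO (maximalIdeal_pow_le_comap σO hσOσO m) ux.1) ^ 2 * (1 - ux.2 ^ 2) +
          Ideal.Quotient.mk _ d₀ * (ux.1 * Ideal.quotientMap (maximalIdeal 𝒪[K] ^ m) σO (maximalIdeal_pow_le_comap σO hσOσO m) ux.1) +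
          Ideal.Quotient.mk _ p₀) = 0) with hQdef
  have hσbar : Ideal.quotientMap (maximalIdeal 𝒪[K] ^ m) σO (maximalIdeal_pow_le_comap σO hσOσO m) =
      Ideal.quotientMap (𝓂[K] ^ m) ((σ.comp 𝒪[K].subtype).codRestrict 𝒪[K] hσO) (maximalIdeal_pow_le_comap_codRestrict σ hd.vϖ hd.vσ hσO m) := rfl
  -- Step A: «good» ⟺ `Q ∘ f`
  have stepA : ∀ w : ↥P ⧸ S, ((Quotient.out w : ↥P) : ↥(unitaryGroupOfForm σ J))⁻¹ * τ * (Quotient.out w : ↥P) ∈ flickerHK σ J c um ↔ Q (f w) := by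
    intro w
    set pp : ↥(unitaryGroupOfForm σ J) := ((Quotient.out w : ↥P) : ↥(unitaryGroupOfForm σ J)) with hpp
    have hp : pp ∈ flickerPH σ J c := (Quotient.out w).2
    obtain ⟨u, x, wc, hpm, hvu, hvx, hσx, hvw, hσw⟩ := exists_coe_eq_borel_of_mem_flickerPH σ hJ hd hc hp
    have hu0 : u ≠ 0 := fun h => by rw [h, map_zero] at hvu; exact zero_ne_one hvu
    have hw0 : wc ≠ 0 := fun h => by rw [h, map_zero] at hvw; exact zero_ne_one hvw
    have hσw0 : σ wc ≠ 0 := fun h => hw0 (by rw [← hd.σσ wc, h, map_zero])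
    have hva : Valued.v (u * wc⁻¹) ≤ 1 := by rw [map_mul, map_inv₀, hvu, hvw, inv_one, one_mul]
    have hρ : f w = (Ideal.Quotient.mk (𝓂[K] ^ m) ⟨u * wc⁻¹, hva⟩, Ideal.Quotient.mk (𝓂[K] ^ m) ⟨x, hvx⟩) := by
      show flickerPHRho σ m pp = _
      rw [flickerPHRho_of_coe_eq σ m hpm hu0, toQuotPow_of_le m hva, toQuotPow_of_le m hvx]
    have hQ1 : Ideal.quotientMap (maximalIdeal 𝒪[K] ^ m) σO (maximalIdeal_pow_le_comap σO hσOσO m) (f w).2 = -(f w).2 := by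
      rw [hσbar]; exact quotientMap_flickerPHRho_snd σ hJ hd hσO hc m hp
    have hQ2 : IsUnit (f w).1 := isUnit_flickerPHRho_fst σ hJ hd hc m hp
    rw [borel_conj_mem_flickerHK_iff_quadratic σ hJ hd hy hmν hνk hc hum hp hpm hτ hτH hB₂ hs]
    -- rewrite `uσu = N(u w⁻¹)`
    have hσwc : σ wc = wc⁻¹ := eq_inv_of_mul_eq_one_left hσw
    have hN : u * σ u = (u * wc⁻¹) * σ (u * wc⁻¹) := by
      rw [map_mul, map_inv₀, hσwc, inv_inv]; field_simp
    rw [hN, v_quadratic_le_iff_factor_eq_zero σ hd hσO hkm hva hvx hdv.le j]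
    rw [hρ] at hQ1 hQ2
    rw [hQdef, hρ]
    exact ⟨fun h => ⟨hQ1, hQ2, h⟩, fun h => h.2.2⟩
  -- Step B: count through `f`
  rw [Nat.card_congr (Equiv.subtypeEquivRight stepA), natCard_subtype_comp_eq_mul f Q F hfib]
  congr 1
  -- Step C: the range condition is implied by `Q` (★ (H3) surjectivity + (H1) + `S ≤ N₀`)
  have stepC : ∀ z, Q z → z ∈ Set.range f := by
    rintro ⟨α, β⟩ ⟨hβ, hα, -⟩
    obtain ⟨a, rfl⟩ := Ideal.Quotient.mk_surjective α
    obtain ⟨bb, rfl⟩ := Ideal.Quotient.mk_surjective β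
    have hau : IsUnit a := isUnit_of_isUnit_mk_pow (R := 𝒪[K]) hm hα
    have hav : Valued.v (a : K) = 1 := (Valuation.Integers.isUnit_iff_valuation_eq_one (Valuation.integer.integers _)).1 hau
    rw [hσbar] at hβ
    obtain ⟨pp, hpp, hρ⟩ := exists_mem_flickerPH_flickerPHRho_eq σ hJ hd hσO hc m a bb hav hβ
    refine ⟨QuotientGroup.mk ⟨pp, hpp⟩, ?_⟩
    obtain ⟨s, hs'⟩ := QuotientGroup.mk_out_eq_mul S (⟨pp, hpp⟩ : ↥P)
    show flickerPHRho σ m ((Quotient.out (QuotientGroup.mk (⟨pp, hpp⟩ : ↥P) : ↥P ⧸ S) : ↥P) : ↥(unitaryGroupOfForm σ J)) = _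
    rw [hs', Subgroup.coe_mul, ← hρ]
    symm
    rw [flickerPHRho_eq_iff σ hJ hd hc m hpp (Subgroup.mul_mem _ hpp (s : ↥P).2), ← mul_assoc, inv_mul_cancel, one_mul]
    exact hSN ⟨(s : ↥P).2, s.2⟩
  rw [Nat.card_congr (Equiv.subtypeEquivRight fun z => (and_iff_right_of_imp (stepC z) : z ∈ Set.range f ∧ Q z ↔ Q z))]
  -- Step D: the pair count at `R = 𝒪[K]`
  exact natCard_pairs_norm_quadratic_eq σO hσOσO ha₀ hq hk hkm h2O hd₀u hσd₀ hp₀m hσp₀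

end RegimeFour

end UnitaryGroup

end Literature.NumberTheory.Automorphic
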